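import Literature.NumberTheory.EllipticCurves.WeierstrassFormalGroupPoints
import Literature.NumberTheory.EllipticCurves.FormalGroupChart
import Literature.NumberTheory.EllipticCurves.FormalGroupXDerivativeProofs
import Literature.NumberTheory.EllipticCurves.FormalGroupNegOmegaProofs
import Literature.NumberTheory.EllipticCurves.FormalGroupLaurentPoints
import Literature.NumberTheory.GaloisRepresentations.LubinTateTorsion
import Literature.NumberTheory.GaloisRepresentations.LubinTateColeman
import HarnessLib

/-!
# The formal group computes `E₁(K)` over every complete ultrametric field, in the `NilIdeal` language:
# `P(t) = (X(t)/t², −X(t)/t³)`, `z(P(t)) = t`, `P = P(z(P))`, `−P(t) = P(i_W(t))` (Silverman AEC VII.2.2, I)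

Topic `Literature/NumberTheory/EllipticCurves`. Let `K` be a complete nontrivially normed ultrametric field with
closed unit ball `𝒪_K = unitBall K` and open unit ball `𝔪_K` (`ballNilIdeal K`, a `LubinTate.NilIdeal` of `𝒪_K`), and let
`W` be a Weierstrass equation over a discrete coefficient ring `A` acting continuously on `𝒪_K`
(`[Algebra A (unitBall K)] [ContinuousSMul A (unitBall K)]`; e.g. `A = ℤ`, or `A = 𝒪_F` for a local subfield `F`).
Write `E = W.curveOver K` for the curve over `K` (an `𝒪_K`-integral equation) and `X = W.formalXMulSq = z²x(z)`
(AEC IV.1). Port to the tree's `LubinTate.evalPt`/`evalAt` evaluation layer of the dictionary proved over normed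
`ℚ_p`-algebras in `Summits/…/Rank1Residual/Additive/FormalGroupBallPoints` (same proofs):

* §0 `ballNilIdeal K`; the evaluation dictionary `evalAt_X'`, `evalAt_C'`, `evalAt_subst₁`, norm bounds
  (`norm_evalAt_le_one`, `norm_evalAt_le_of_constantCoeff`).
* §1 `curveOver`, `isIntegral_curveOver`; `evX t = X(t)`, `‖X(t)‖ = 1`, the chart equation (`formalXMulSq_sq_eq` at `t`).
* §2 **`ptOfZ W K t = (X(t)/t², −X(t)/t³) ∈ E(K)`** (`= O` for `t = 0`), `ptOfZ_mem_kernel` (`∈ E₁(K)`, tree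
  `FormalGroupChart.kernel`), **`zCoord_ptOfZ = t`**, **`eq_ptOfZ_zCoord`**: every `P ∈ E₁(K)` is `P(z(P))`
  (`zCoord_injOn`).
* §3 **`neg_ptOfZ`: `−P(t) = P(i_W(t))`** (`formalXMulSq_subst_formalNeg_mul_X_sq`, `formalXMulSq_mul_formalNeg_add`
  at `t`; field algebra `neg_aux_x/y` of `FormalGroupLaurentPoints`).

The sequel proves `P(u) + P(v) = P(F_W(u, v))`, i.e. that `t ↦ P(t)` is a group isomorphism `Ŵ(𝔪_K) = W.Pt (ballNilIdeal K) ≃ E₁(K)`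
(AEC VII.2.2). BSD / K★ (`Cruxes/StarredOptimalManinUnitFiveSeven/Lines/kato-lever-hDR-sector-iii-periods.md` §5 (M1)):
the matching of `T_pŴ(𝒪_{ℂ_F})` with `T_pE`; nothing about elliptic curves over number fields is proved here.

## References
* J. H. Silverman, *The Arithmetic of Elliptic Curves* (2009), IV.1 (`x(z), y(z)`), Prop. VII.2.2. [SilvermanAEC2009]
* J.-P. Serre, *Local class field theory*, Cassels–Fröhlich Ch. VI §3.2. [CasselsFrohlichANT1967]
-/

noncomputable section

open scoped Classical NNReal
open PowerSeries

namespace Literature.NumberTheory.EllipticCurves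

open Literature.NumberTheory.GaloisRepresentations.LubinTate
open Literature.NumberTheory.EllipticCurves.FormalGroupChart _root_.WeierstrassCurve

/-! ## §0 The open unit ball as a nil ideal; evaluation dictionary -/

section Eval

variable (K : Type*) [NontriviallyNormedField K] [IsUltrametricDist K]

/-- **`𝔪_K = {‖t‖ < 1} ⊂ 𝒪_K` as a closed nil ideal** of the complete linearly topologised ring `𝒪_K = unitBall K`
(the domain of the formal-group points; for `K = ℂ_F` this is the tree's `maxNilIdealC F`, for a Lubin–Tate field
`maxNilIdeal`). [cite: CasselsFrohlichANT1967, Ch. VI §3.2] -/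
def ballNilIdeal : NilIdeal (unitBall K) where
  toIdeal := ballIdeal K one_pos
  isClosed := isClosed_ballIdeal_one K
  isTopologicallyNilpotent _ hx := isTopologicallyNilpotent_of_norm_lt_one K hx

variable {K}

/-- Membership in `𝔪_K`: `‖t‖ < 1`. [cite: CasselsFrohlichANT1967, Ch. VI §3.2] -/
theorem mem_ballNilIdeal_iff {t : unitBall K} : t ∈ (ballNilIdeal K).toIdeal ↔ ‖(t : K)‖ < 1 := Iff.rfl

/-- `‖t‖ < 1` for `t ∈ 𝔪_K`. [cite: CasselsFrohlichANT1967, Ch. VI §3.2] -/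
theorem norm_lt_one_of_mem (t : (ballNilIdeal K).toIdeal) : ‖((t : unitBall K) : K)‖ < 1 := t.2

/-- An element of `K` of norm `< 1` as a point of `𝔪_K`. [cite: CasselsFrohlichANT1967, Ch. VI §3.2] -/
def mkBallPt (x : K) (hx : ‖x‖ < 1) : (ballNilIdeal K).toIdeal :=
  ⟨⟨x, (mem_unitBall_iff K).mpr hx.le⟩, hx⟩

/-- Unfolding `mkBallPt`. [cite: CasselsFrohlichANT1967, Ch. VI §3.2] -/
@[simp] theorem coe_coe_mkBallPt (x : K) (hx : ‖x‖ < 1) : (((mkBallPt x hx : (ballNilIdeal K).toIdeal) : unitBall K) : K) = x :=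
  rfl

variable {A : Type*} [CommRing A] [UniformSpace A] [DiscreteUniformity A]
  [CompleteSpace K] [Algebra A (unitBall K)] [ContinuousSMul A (unitBall K)]

/-- `evalAt t X = t`. [cite: CasselsFrohlichANT1967, Ch. VI §3.2] -/
theorem evalAt_X' (t : (ballNilIdeal K).toIdeal) : evalAt (ballNilIdeal K) t (PowerSeries.X : PowerSeries A) = (t : unitBall K) := by
  rw [← coe_evalPt₁_eq_evalAt (ballNilIdeal K) PowerSeries.X PowerSeries.constantCoeff_X t]
  exact congrArg Subtype.val (evalPt_X (ballNilIdeal K) () (fun _ => t))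

/-- `evalAt t (C a) = a`. [cite: CasselsFrohlichANT1967, Ch. VI §3.2] -/
theorem evalAt_C' (t : (ballNilIdeal K).toIdeal) (a : A) :
    evalAt (ballNilIdeal K) t (PowerSeries.C a) = algebraMap A (unitBall K) a := by
  rw [show (PowerSeries.C a : PowerSeries A) = algebraMap A (PowerSeries A) a from rfl, AlgHom.commutes]

/-- **Substitution compatibility**: `(h ∘ g)(t) = h(g(t))` for `g` without constant term.
[cite: CasselsFrohlichANT1967, Ch. VI §3.2] -/
theorem evalAt_subst₁ (t : (ballNilIdeal K).toIdeal) (g : PowerSeries A) (hg : PowerSeries.constantCoeff g = 0)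
    (h : PowerSeries A) :
    evalAt (ballNilIdeal K) t (h.subst g) = evalAt (ballNilIdeal K) (evalPt₁ (ballNilIdeal K) g hg t) h := by
  change MvPowerSeries.aeval ((ballNilIdeal K).hasEval fun _ : Unit => t) (MvPowerSeries.subst (fun _ : Unit => g) h) =
    MvPowerSeries.aeval ((ballNilIdeal K).hasEval fun _ : Unit => evalPt₁ (ballNilIdeal K) g hg t) h
  exact aeval_subst (MvPowerSeries.hasSubst_of_constantCoeff_zero fun _ => hg) _ h _ (fun _ => rfl)

omit [CompleteSpace K] in
/-- `‖h(t)‖ ≤ 1` (values in `𝒪_K`). [cite: CasselsFrohlichANT1967, Ch. VI §3.2] -/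
theorem norm_coe_unitBall_le_one (x : unitBall K) : ‖(x : K)‖ ≤ 1 := (mem_unitBall_iff K).mp x.2

/-- **`‖h(t)‖ ≤ ‖t‖` for `h` without constant term** (`h = X · g`). [cite: CasselsFrohlichANT1967, Ch. VI §3.2] -/
theorem norm_evalAt_le_of_constantCoeff (t : (ballNilIdeal K).toIdeal) {h : PowerSeries A}
    (hh : PowerSeries.constantCoeff h = 0) : ‖((evalAt (ballNilIdeal K) t h : unitBall K) : K)‖ ≤ ‖((t : unitBall K) : K)‖ := by
  obtain ⟨g, rfl⟩ := PowerSeries.X_dvd_iff.mpr hh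
  rw [map_mul, evalAt_X', Subring.coe_mul, norm_mul]
  exact mul_le_of_le_one_right (norm_nonneg _) (norm_coe_unitBall_le_one _)

/-- `‖g(t)‖ < 1` for `g` without constant term: the point `evalPt₁ g t` of `𝔪_K`, read in `K`.
[cite: CasselsFrohlichANT1967, Ch. VI §3.2] -/
theorem norm_evalPt₁_lt_one (t : (ballNilIdeal K).toIdeal) (g : PowerSeries A) (hg : PowerSeries.constantCoeff g = 0) :
    ‖(((evalPt₁ (ballNilIdeal K) g hg t : (ballNilIdeal K).toIdeal) : unitBall K) : K)‖ < 1 :=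
  (evalPt₁ (ballNilIdeal K) g hg t).2

end Eval

/-! ## §1 The curve over `K`, `X(t)` and the Weierstrass equation in the chart -/

section Curve

variable {A : Type*} [CommRing A] [UniformSpace A] [DiscreteUniformity A]
  (K : Type*) [NontriviallyNormedField K] [IsUltrametricDist K] [CompleteSpace K]
  [Algebra A (unitBall K)] [ContinuousSMul A (unitBall K)] (W : WeierstrassCurve A)

/-- The integral model `W ⊗_A 𝒪_K`. [cite: SilvermanAEC2009, VII.1] -/
def ballIntModel : WeierstrassCurve (unitBall K) := W.map (algebraMap A (unitBall K))

/-- **`E = W ⊗_A K`**, the curve over `K` (base change of the integral model along `𝒪_K ⊆ K`). [cite: SilvermanAEC2009, VII.1] -/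
def curveOver : WeierstrassCurve K := (ballIntModel K W).baseChange K

/-- `E` is an `𝒪_K`-integral equation (for the valuation `‖·‖` of `K`). [cite: SilvermanAEC2009, VII.1] -/
instance isIntegral_curveOver : (curveOver K W).IsIntegral (NormedField.valuation (K := K)).integer :=
  ⟨⟨ballIntModel K W, rfl⟩⟩

variable {K W}

/-- The image in `K` of a coefficient. [cite: SilvermanAEC2009, VII.1] -/
def cK (K : Type*) [NontriviallyNormedField K] [IsUltrametricDist K] [Algebra A (unitBall K)] (a : A) : K :=
  ((algebraMap A (unitBall K) a : unitBall K) : K)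

omit [UniformSpace A] [DiscreteUniformity A] [CompleteSpace K] [ContinuousSMul A (unitBall K)] in
/-- The coefficients of `E`. [cite: SilvermanAEC2009, VII.1] -/
theorem curveOver_a : (curveOver K W).a₁ = cK K W.a₁ ∧ (curveOver K W).a₂ = cK K W.a₂ ∧ (curveOver K W).a₃ = cK K W.a₃ ∧
    (curveOver K W).a₄ = cK K W.a₄ ∧ (curveOver K W).a₆ = cK K W.a₆ :=
  ⟨rfl, rfl, rfl, rfl, rfl⟩

variable (W) in
/-- **`X(t) ∈ K`**, the value of `X = z²x(z) = formalXMulSq` at `t ∈ 𝔪_K`. [cite: SilvermanAEC2009, IV.1] -/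
def evX (t : (ballNilIdeal K).toIdeal) : K := ((evalAt (ballNilIdeal K) t W.formalXMulSq : unitBall K) : K)

/-- `‖X(t) − 1‖ ≤ ‖t‖` (`X = 1 + O(z)`). [cite: SilvermanAEC2009, IV.1] -/
theorem norm_evX_sub_one_le (t : (ballNilIdeal K).toIdeal) : ‖evX W t - 1‖ ≤ ‖((t : unitBall K) : K)‖ := by
  have h0 : PowerSeries.constantCoeff (W.formalXMulSq - 1) = 0 := by
    rw [map_sub, W.constantCoeff_formalXMulSq, map_one, sub_self]
  have h := norm_evalAt_le_of_constantCoeff t h0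
  rwa [map_sub, map_one, AddSubgroupClass.coe_sub, OneMemClass.coe_one] at h

/-- **`‖X(t)‖ = 1`.** [cite: SilvermanAEC2009, IV.1] -/
theorem norm_evX (t : (ballNilIdeal K).toIdeal) : ‖evX W t‖ = 1 := by
  have h := (norm_evX_sub_one_le (W := W) t).trans_lt (norm_lt_one_of_mem t)
  have e : evX W t = 1 + (evX W t - 1) := by ring
  rw [e, IsUltrametricDist.norm_add_eq_max_of_norm_ne_norm, norm_one, max_eq_left h.le]
  rw [norm_one]; exact (ne_of_lt h).symm

/-- `X(t) ≠ 0`. [cite: SilvermanAEC2009, IV.1] -/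
theorem evX_ne_zero (t : (ballNilIdeal K).toIdeal) : evX W t ≠ 0 := by
  rw [← norm_ne_zero_iff, norm_evX]; exact one_ne_zero

/-- **The Weierstrass equation in the chart at `t`**: `A² = A³ + a₁sA² + a₂s²A² + a₃s³A + a₄s⁴A + a₆s⁶` with `A = X(t)`,
`s = t` (the tree's `formalXMulSq_sq_eq` evaluated). [cite: SilvermanAEC2009, IV.1] -/
theorem equation_chart (t : (ballNilIdeal K).toIdeal) :
    evX W t ^ 2 = evX W t ^ 3 + cK K W.a₁ * ((t : unitBall K) : K) * evX W t ^ 2 +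
      cK K W.a₂ * ((t : unitBall K) : K) ^ 2 * evX W t ^ 2 + cK K W.a₃ * ((t : unitBall K) : K) ^ 3 * evX W t +
      cK K W.a₄ * ((t : unitBall K) : K) ^ 4 * evX W t + cK K W.a₆ * ((t : unitBall K) : K) ^ 6 := by
  have h := congrArg (fun f => ((evalAt (ballNilIdeal K) t f : unitBall K) : K)) W.formalXMulSq_sq_eq
  simp only [map_add, map_mul, map_pow, evalAt_X', evalAt_C', Subring.coe_add, Subring.coe_mul,
    SubmonoidClass.coe_pow] at h
  exact h

/-- The affine coordinates of the formal point satisfy the Weierstrass equation of `E`. [cite: SilvermanAEC2009, IV.1] -/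
theorem equation_ptOfZ (t : (ballNilIdeal K).toIdeal) (ht0 : ((t : unitBall K) : K) ≠ 0) :
    (curveOver K W).toAffine.Equation (evX W t / ((t : unitBall K) : K) ^ 2) (-evX W t / ((t : unitBall K) : K) ^ 3) := by
  have hid := equation_chart (W := W) t
  have hs6 : ((t : unitBall K) : K) ^ 6 ≠ 0 := pow_ne_zero 6 ht0
  rw [Affine.equation_iff]
  simp only [curveOver, ballIntModel]
  change _ + ((algebraMap A (unitBall K) W.a₁ : unitBall K) : K) * _ * _ + ((algebraMap A (unitBall K) W.a₃ : unitBall K) : K) * _ =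
    _ + ((algebraMap A (unitBall K) W.a₂ : unitBall K) : K) * _ + ((algebraMap A (unitBall K) W.a₄ : unitBall K) : K) * _ +
      ((algebraMap A (unitBall K) W.a₆ : unitBall K) : K)
  set X : K := evX W t
  set s : K := ((t : unitBall K) : K)
  have e1 : (-X / s ^ 3) ^ 2 + cK K W.a₁ * (X / s ^ 2) * (-X / s ^ 3) + cK K W.a₃ * (-X / s ^ 3) =
      (X ^ 2 - cK K W.a₁ * s * X ^ 2 - cK K W.a₃ * s ^ 3 * X) / s ^ 6 := by
    field_simp
    ring
  have e2 : (X / s ^ 2) ^ 3 + cK K W.a₂ * (X / s ^ 2) ^ 2 + cK K W.a₄ * (X / s ^ 2) + cK K W.a₆ =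
      (X ^ 3 + cK K W.a₂ * s ^ 2 * X ^ 2 + cK K W.a₄ * s ^ 4 * X + cK K W.a₆ * s ^ 6) / s ^ 6 := by
    field_simp
  change (-X / s ^ 3) ^ 2 + cK K W.a₁ * (X / s ^ 2) * (-X / s ^ 3) + cK K W.a₃ * (-X / s ^ 3) =
    (X / s ^ 2) ^ 3 + cK K W.a₂ * (X / s ^ 2) ^ 2 + cK K W.a₄ * (X / s ^ 2) + cK K W.a₆
  rw [e1, e2, div_left_inj' hs6]
  linear_combination hid

variable [hE : (curveOver K W).IsElliptic]

/-- The formal point is nonsingular (`E` elliptic). [cite: SilvermanAEC2009, IV.1] -/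
theorem nonsingular_ptOfZ (t : (ballNilIdeal K).toIdeal) (ht0 : ((t : unitBall K) : K) ≠ 0) :
    (curveOver K W).toAffine.Nonsingular (evX W t / ((t : unitBall K) : K) ^ 2) (-evX W t / ((t : unitBall K) : K) ^ 3) :=
  (Affine.equation_iff_nonsingular (W := curveOver K W)).mp (equation_ptOfZ t ht0)

/-! ## §2 The formal point `P(t)` and the dictionary -/

variable (K W) in
/-- **The formal point `P(t) = (X(t)/t², −X(t)/t³) ∈ E(K)`** with parameter `t ∈ 𝔪_K` (`P(0) = O`).
[cite: SilvermanAEC2009, Prop. VII.2.2] -/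
def ptOfZ (t : (ballNilIdeal K).toIdeal) : (curveOver K W).toAffine.Point :=
  if ht0 : ((t : unitBall K) : K) = 0 then 0 else .some _ _ (nonsingular_ptOfZ t ht0)

/-- `P(t) = O` when `t = 0`. [cite: SilvermanAEC2009, Prop. VII.2.2] -/
theorem ptOfZ_of_eq_zero {t : (ballNilIdeal K).toIdeal} (ht0 : ((t : unitBall K) : K) = 0) : ptOfZ K W t = 0 := by
  rw [ptOfZ, dif_pos ht0]

/-- `P(0) = O`. [cite: SilvermanAEC2009, Prop. VII.2.2] -/
@[simp] theorem ptOfZ_zero : ptOfZ K W 0 = 0 := ptOfZ_of_eq_zero rfl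

/-- `P(t) = (X(t)/t², −X(t)/t³)` when `t ≠ 0`. [cite: SilvermanAEC2009, Prop. VII.2.2] -/
theorem ptOfZ_of_ne_zero {t : (ballNilIdeal K).toIdeal} (ht0 : ((t : unitBall K) : K) ≠ 0) :
    ptOfZ K W t = .some _ _ (nonsingular_ptOfZ t ht0) := by
  rw [ptOfZ, dif_neg ht0]

/-- `ptOfZ` depends only on the underlying element of `K`. [cite: SilvermanAEC2009, Prop. VII.2.2] -/
theorem ptOfZ_congr {t t' : (ballNilIdeal K).toIdeal} (h : ((t : unitBall K) : K) = (t' : unitBall K)) :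
    ptOfZ K W t = ptOfZ K W t' := by
  obtain rfl : t = t' := Subtype.ext (Subtype.ext h)
  rfl

/-- **`P(t) ∈ E₁(K)`** (`‖x(P(t))‖ = ‖t‖⁻² > 1`). [cite: SilvermanAEC2009, Prop. VII.2.2] -/
theorem ptOfZ_mem_kernel (t : (ballNilIdeal K).toIdeal) :
    ptOfZ K W t ∈ kernel (NormedField.valuation (K := K)) (curveOver K W) := by
  by_cases ht0 : ((t : unitBall K) : K) = 0
  · rw [ptOfZ_of_eq_zero ht0]; exact (kernel (NormedField.valuation (K := K)) (curveOver K W)).zero_mem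
  · rw [ptOfZ_of_ne_zero ht0]
    refine some_mem_kernel _ ?_
    rw [← NNReal.coe_lt_coe, NormedField.valuation_apply, coe_nnnorm, NNReal.coe_one, norm_div, norm_pow, norm_evX]
    have h0 : 0 < ‖((t : unitBall K) : K)‖ := norm_pos_iff.mpr ht0
    rw [lt_div_iff₀ (pow_pos h0 2), one_mul]
    have h1 := norm_lt_one_of_mem t
    nlinarith

/-- **`z(P(t)) = t`.** [cite: SilvermanAEC2009, Prop. VII.2.2] -/
theorem zCoord_ptOfZ (t : (ballNilIdeal K).toIdeal) :
    (ptOfZ K W t).zCoord = ((t : unitBall K) : K) := by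
  by_cases ht0 : ((t : unitBall K) : K) = 0
  · rw [ptOfZ_of_eq_zero ht0, ht0]; rfl
  · rw [ptOfZ_of_ne_zero ht0, Affine.Point.zCoord_some]
    have hX := evX_ne_zero (W := W) t
    field_simp

omit [UniformSpace A] [DiscreteUniformity A] [CompleteSpace K] [ContinuousSMul A (unitBall K)] hE in
/-- `‖z(P)‖ < 1` on `E₁(K)`. [cite: SilvermanAEC2009, Prop. VII.2.2] -/
theorem norm_zCoord_lt_one {P : (curveOver K W).toAffine.Point}
    (hP : P ∈ kernel (NormedField.valuation (K := K)) (curveOver K W)) :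
    ‖P.zCoord‖ < 1 := by
  have h := val_zCoord_lt_one hP
  rwa [← NNReal.coe_lt_coe, NormedField.valuation_apply, coe_nnnorm, NNReal.coe_one] at h

/-- **The parameter `z(P) ∈ 𝔪_K`** of a point of `E₁(K)`. [cite: SilvermanAEC2009, Prop. VII.2.2] -/
def zPt (P : (curveOver K W).toAffine.Point)
    (hP : P ∈ kernel (NormedField.valuation (K := K)) (curveOver K W)) :
    (ballNilIdeal K).toIdeal :=
  mkBallPt P.zCoord (norm_zCoord_lt_one hP)

omit [UniformSpace A] [DiscreteUniformity A] [CompleteSpace K] [ContinuousSMul A (unitBall K)] hE in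
/-- `(zPt P : K) = z(P)`. [cite: SilvermanAEC2009, Prop. VII.2.2] -/
@[simp] theorem coe_zPt {P : (curveOver K W).toAffine.Point}
    (hP : P ∈ kernel (NormedField.valuation (K := K)) (curveOver K W)) :
    (((zPt P hP : (ballNilIdeal K).toIdeal) : unitBall K) : K) = P.zCoord := rfl

/-- **Every point of `E₁(K)` is the formal point of its parameter: `P = P(z(P))`** (injectivity of `z` on `E₁`, tree
`zCoord_injOn`). [cite: SilvermanAEC2009, Prop. VII.2.2] -/
theorem eq_ptOfZ_zPt {P : (curveOver K W).toAffine.Point}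
    (hP : P ∈ kernel (NormedField.valuation (K := K)) (curveOver K W)) :
    P = ptOfZ K W (zPt P hP) :=
  zCoord_injOn hP (ptOfZ_mem_kernel _) (by rw [zCoord_ptOfZ]; rfl)

/-- `z(P(t))` as a point of `𝔪_K` is `t`. [cite: SilvermanAEC2009, Prop. VII.2.2] -/
theorem zPt_ptOfZ (t : (ballNilIdeal K).toIdeal) : zPt (ptOfZ K W t) (ptOfZ_mem_kernel t) = t :=
  Subtype.ext (Subtype.ext (zCoord_ptOfZ t))

omit [UniformSpace A] [DiscreteUniformity A] [CompleteSpace K] [ContinuousSMul A (unitBall K)] hE in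
/-- Two points of `E₁(K)` with the same parameter are equal. [cite: SilvermanAEC2009, Prop. VII.2.2] -/
theorem eq_of_zCoord_eq {P Q : (curveOver K W).toAffine.Point}
    (hP : P ∈ kernel (NormedField.valuation (K := K)) (curveOver K W))
    (hQ : Q ∈ kernel (NormedField.valuation (K := K)) (curveOver K W))
    (h : P.zCoord = Q.zCoord) : P = Q :=
  zCoord_injOn hP hQ h

/-- `P(t) = P(t') ↔ t = t'` (`t ↦ P(t)` is injective). [cite: SilvermanAEC2009, Prop. VII.2.2] -/
theorem ptOfZ_injective : Function.Injective (ptOfZ K W) := fun t t' h => by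
  rw [← zPt_ptOfZ (W := W) t, ← zPt_ptOfZ (W := W) t']
  exact Subtype.ext (Subtype.ext (by rw [coe_zPt, coe_zPt, h]))

/-! ## §3 Negation: `−P(t) = P(i_W(t))` -/

omit hE in
/-- `i_W(t) ≠ 0` for `t ≠ 0` (`i(i(t)) = t`). [cite: SilvermanAEC2009, IV.1] -/
theorem evalPt₁_formalNeg_ne_zero {t : (ballNilIdeal K).toIdeal} (ht0 : ((t : unitBall K) : K) ≠ 0) :
    (((evalPt₁ (ballNilIdeal K) W.formalNeg W.constantCoeff_formalNeg t : (ballNilIdeal K).toIdeal) : unitBall K) : K) ≠ 0 := by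
  intro h
  have hii : evalPt₁ (ballNilIdeal K) W.formalNeg W.constantCoeff_formalNeg
      (evalPt₁ (ballNilIdeal K) W.formalNeg W.constantCoeff_formalNeg t) = t := by
    have hc : MvPowerSeries.constantCoeff (PowerSeries.subst W.formalNeg W.formalNeg : MvPowerSeries Unit A) = 0 := by
      rw [W.formalNeg_subst_formalNeg_eq_X]; exact PowerSeries.constantCoeff_X
    have e := evalPt₁_subst (ballNilIdeal K) (W.formalNeg : MvPowerSeries Unit A) W.constantCoeff_formalNeg W.formalNeg
      W.constantCoeff_formalNeg hc (fun _ => t)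
    have e2 : evalPt (ballNilIdeal K) (PowerSeries.subst W.formalNeg W.formalNeg : MvPowerSeries Unit A) hc (fun _ => t) = t :=
      (evalPt_congr (ballNilIdeal K) W.formalNeg_subst_formalNeg_eq_X hc (MvPowerSeries.constantCoeff_X ()) _).trans
        (evalPt_X (ballNilIdeal K) () (fun _ => t))
    exact e.symm.trans e2
  have h0 : evalPt₁ (ballNilIdeal K) W.formalNeg W.constantCoeff_formalNeg t = 0 := Subtype.ext (Subtype.ext h)
  rw [h0] at hii
  have hz : (((evalPt₁ (ballNilIdeal K) W.formalNeg W.constantCoeff_formalNeg (0 : (ballNilIdeal K).toIdeal) :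
      (ballNilIdeal K).toIdeal) : unitBall K) : K) = 0 := by
    have hle := norm_evalAt_le_of_constantCoeff (K := K) (0 : (ballNilIdeal K).toIdeal) W.constantCoeff_formalNeg
    rw [ZeroMemClass.coe_zero, ZeroMemClass.coe_zero, norm_zero] at hle
    exact norm_le_zero_iff.mp hle
  rw [hii] at hz
  exact ht0 hz

/-- **`−P(t) = P(i_W(t))`** (`x(i(z)) = x(z)`, `y(i(z)) = −y − a₁x − a₃`: the tree's formal identities
`formalXMulSq_subst_formalNeg_mul_X_sq`, `formalXMulSq_mul_formalNeg_add` evaluated at `t`, then the field algebra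
`neg_aux_x/y`). [cite: SilvermanAEC2009, IV.1] -/
theorem neg_ptOfZ (t : (ballNilIdeal K).toIdeal) :
    -ptOfZ K W t = ptOfZ K W (evalPt₁ (ballNilIdeal K) W.formalNeg W.constantCoeff_formalNeg t) := by
  by_cases ht0 : ((t : unitBall K) : K) = 0
  · have hi0 : (((evalPt₁ (ballNilIdeal K) W.formalNeg W.constantCoeff_formalNeg t : (ballNilIdeal K).toIdeal) :
        unitBall K) : K) = 0 := by
      have hle := norm_evalAt_le_of_constantCoeff (K := K) t W.constantCoeff_formalNeg
      rw [ht0, norm_zero] at hle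
      exact norm_le_zero_iff.mp hle
    rw [ptOfZ_of_eq_zero ht0, neg_zero, ptOfZ_of_eq_zero hi0]
  have hi0 := evalPt₁_formalNeg_ne_zero (W := W) ht0
  rw [ptOfZ_of_ne_zero ht0, ptOfZ_of_ne_zero hi0, Affine.Point.neg_some, Affine.Point.some.injEq]
  have h1 := congrArg (fun f => ((evalAt (ballNilIdeal K) t f : unitBall K) : K)) W.formalXMulSq_subst_formalNeg_mul_X_sq
  have h2 := congrArg (fun f => ((evalAt (ballNilIdeal K) t f : unitBall K) : K)) W.formalXMulSq_mul_formalNeg_add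
  simp only [map_mul, map_pow, map_add, map_sub, evalAt_X', evalAt_C', Subring.coe_mul, SubmonoidClass.coe_pow,
    Subring.coe_add, AddSubgroupClass.coe_sub] at h1 h2
  rw [evalAt_subst₁ t W.formalNeg W.constantCoeff_formalNeg] at h1
  rw [← coe_evalPt₁_eq_evalAt (ballNilIdeal K) W.formalNeg W.constantCoeff_formalNeg] at h1 h2
  simp only [Affine.negY, curveOver, ballIntModel]
  refine ⟨neg_aux_x ht0 hi0 h1, ?_⟩
  change -(-evX W t / ((t : unitBall K) : K) ^ 3) - cK K W.a₁ * (evX W t / ((t : unitBall K) : K) ^ 2) - cK K W.a₃ = _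
  exact neg_aux_y ht0 hi0 h1 h2

/-- **Negation read through parameters: `z(−P) = i_W(z(P))` on `E₁(K)`.** [cite: SilvermanAEC2009, IV.1] -/
theorem zPt_neg {P : (curveOver K W).toAffine.Point}
    (hP : P ∈ kernel (NormedField.valuation (K := K)) (curveOver K W)) :
    zPt (-P) ((kernel (NormedField.valuation (K := K)) (curveOver K W)).neg_mem hP) =
      evalPt₁ (ballNilIdeal K) W.formalNeg W.constantCoeff_formalNeg (zPt P hP) := by
  have h : -P = ptOfZ K W (evalPt₁ (ballNilIdeal K) W.formalNeg W.constantCoeff_formalNeg (zPt P hP)) :=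
    (congrArg Neg.neg (eq_ptOfZ_zPt hP)).trans (neg_ptOfZ _)
  apply Subtype.ext; apply Subtype.ext
  rw [coe_zPt, h, zCoord_ptOfZ]

end Curve

end Literature.NumberTheory.EllipticCurves

end

/-! ## §4 (appended) Naturality: continuous `A`-algebra maps `𝒪_K → 𝒪_L` (base extension, Galois) -/

noncomputable section

namespace Literature.NumberTheory.EllipticCurves

section NaturalityDefs

open Literature.NumberTheory.GaloisRepresentations.LubinTate

variable {A : Type*} [CommRing A] {K : Type*} [NontriviallyNormedField K] [IsUltrametricDist K] [Algebra A (unitBall K)]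
  {L : Type*} [NontriviallyNormedField L] [IsUltrametricDist L] [Algebra A (unitBall L)]
  (ε : unitBall K →ₐ[A] unitBall L) (hεm : ∀ x ∈ (ballNilIdeal K).toIdeal, ε x ∈ (ballNilIdeal L).toIdeal)

/-- The image point `ε(t) ∈ 𝔪_L` of `t ∈ 𝔪_K` under an `A`-algebra map `ε : 𝒪_K → 𝒪_L` with `ε(𝔪_K) ⊆ 𝔪_L`
(a base extension `K ⊆ L`, or an isometric automorphism fixing the coefficients). [cite: CasselsFrohlichANT1967, Ch. VI §3.2] -/
def mapBallPt (t : (ballNilIdeal K).toIdeal) : (ballNilIdeal L).toIdeal := ⟨ε t, hεm _ t.2⟩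

/-- Unfolding `mapBallPt`. [cite: CasselsFrohlichANT1967, Ch. VI §3.2] -/
@[simp] theorem coe_mapBallPt (t : (ballNilIdeal K).toIdeal) : ((mapBallPt ε hεm t : (ballNilIdeal L).toIdeal) : unitBall L) = ε t :=
  rfl

/-- `ε t = 0 ↔ t = 0` when `ε` is the restriction of a field homomorphism `φ : K → L`. [cite: CasselsFrohlichANT1967, Ch. VI §3.2] -/
theorem coe_mapBallPt_eq_zero_iff (φ : K →+* L) (hφ : ∀ x : unitBall K, φ x = ε x) (t : (ballNilIdeal K).toIdeal) :
    (((mapBallPt ε hεm t : (ballNilIdeal L).toIdeal) : unitBall L) : L) = 0 ↔ ((t : unitBall K) : K) = 0 := by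
  rw [coe_mapBallPt, ← hφ, map_eq_zero_iff φ φ.injective]

end NaturalityDefs

section Naturality

open scoped Classical NNReal
open Literature.NumberTheory.GaloisRepresentations.LubinTate
open Literature.NumberTheory.EllipticCurves.FormalGroupChart _root_.WeierstrassCurve

variable {A : Type*} [CommRing A] [UniformSpace A] [DiscreteUniformity A]
  {K : Type*} [NontriviallyNormedField K] [IsUltrametricDist K] [CompleteSpace K]
  [Algebra A (unitBall K)] [ContinuousSMul A (unitBall K)]
  {L : Type*} [NontriviallyNormedField L] [IsUltrametricDist L] [CompleteSpace L]
  [Algebra A (unitBall L)] [ContinuousSMul A (unitBall L)] {W : WeierstrassCurve A}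

/-- `mapBallPt` is the coordinate of `WeierstrassCurve.Pt.map` (the induced homomorphism `Ŵ(𝔪_K) →+ Ŵ(𝔪_L)`).
[cite: CasselsFrohlichANT1967, Ch. VI §3.2] -/
theorem val_ptMap_eq_mapBallPt (ε : unitBall K →ₐ[A] unitBall L) (hε : Continuous ε)
    (hεm : ∀ x ∈ (ballNilIdeal K).toIdeal, ε x ∈ (ballNilIdeal L).toIdeal) (P : W.Pt (ballNilIdeal K)) :
    (WeierstrassCurve.Pt.map W (ballNilIdeal K) (ballNilIdeal L) ε hε hεm P).val = mapBallPt ε hεm P.val := rfl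

/-- **`ε(h(t)) = h(ε t)`** for every power series `h` over `A` (continuity of `ε`). [cite: CasselsFrohlichANT1967, Ch. VI §3.2] -/
theorem map_evalAt (ε : unitBall K →ₐ[A] unitBall L) (hε : Continuous ε)
    (hεm : ∀ x ∈ (ballNilIdeal K).toIdeal, ε x ∈ (ballNilIdeal L).toIdeal) (t : (ballNilIdeal K).toIdeal) (h : PowerSeries A) :
    ε (evalAt (ballNilIdeal K) t h) = evalAt (ballNilIdeal L) (mapBallPt ε hεm t) h :=
  algHom_evalAt (ballNilIdeal K) (ballNilIdeal L) ε hε h t _ rfl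

/-- **`X(ε t) = ε(X(t))`**. [cite: SilvermanAEC2009, IV.1] -/
theorem evX_mapBallPt (ε : unitBall K →ₐ[A] unitBall L) (hε : Continuous ε)
    (hεm : ∀ x ∈ (ballNilIdeal K).toIdeal, ε x ∈ (ballNilIdeal L).toIdeal) (t : (ballNilIdeal K).toIdeal) :
    evX W (mapBallPt ε hεm t) = ((ε (evalAt (ballNilIdeal K) t W.formalXMulSq) : unitBall L) : L) := by
  rw [evX, ← map_evalAt ε hε hεm]

/-- **The coordinates of the formal point are natural**: `x(P(ε t)) = φ(x(P(t)))` and `y(P(ε t)) = φ(y(P(t)))` for a field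
homomorphism `φ : K → L` restricting to `ε` on `𝒪_K`. With `φ = σ` an isometric automorphism fixing the coefficients this is
the Galois equivariance of `t ↦ P(t)`; with `K ⊆ L` it is compatibility with base extension. [cite: SilvermanAEC2009, Prop. VII.2.2] -/
theorem evX_div_mapBallPt (ε : unitBall K →ₐ[A] unitBall L) (hε : Continuous ε)
    (hεm : ∀ x ∈ (ballNilIdeal K).toIdeal, ε x ∈ (ballNilIdeal L).toIdeal) (φ : K →+* L) (hφ : ∀ x : unitBall K, φ x = ε x)
    (t : (ballNilIdeal K).toIdeal) :
    evX W (mapBallPt ε hεm t) / (((mapBallPt ε hεm t : (ballNilIdeal L).toIdeal) : unitBall L) : L) ^ 2 =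
        φ (evX W t / ((t : unitBall K) : K) ^ 2) ∧
      -evX W (mapBallPt ε hεm t) / (((mapBallPt ε hεm t : (ballNilIdeal L).toIdeal) : unitBall L) : L) ^ 3 =
        φ (-evX W t / ((t : unitBall K) : K) ^ 3) := by
  rw [evX_mapBallPt ε hε hεm, coe_mapBallPt, ← hφ, ← hφ, map_div₀, map_div₀, map_neg, map_pow, map_pow]
  exact ⟨rfl, rfl⟩

variable [hEL : (curveOver L W).IsElliptic]

/-- **`P(ε t) = (φ x, φ y)` when `P(t) = (x, y)`** (`t ≠ 0`): the formal point of the image parameter has the image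
coordinates. [cite: SilvermanAEC2009, Prop. VII.2.2] -/
theorem ptOfZ_mapBallPt_of_ne_zero (ε : unitBall K →ₐ[A] unitBall L) (hε : Continuous ε)
    (hεm : ∀ x ∈ (ballNilIdeal K).toIdeal, ε x ∈ (ballNilIdeal L).toIdeal) (φ : K →+* L) (hφ : ∀ x : unitBall K, φ x = ε x)
    (t : (ballNilIdeal K).toIdeal) (ht0 : ((t : unitBall K) : K) ≠ 0) :
    ∃ h, ptOfZ L W (mapBallPt ε hεm t) =
      .some (φ (evX W t / ((t : unitBall K) : K) ^ 2)) (φ (-evX W t / ((t : unitBall K) : K) ^ 3)) h := by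
  have ht0' : (((mapBallPt ε hεm t : (ballNilIdeal L).toIdeal) : unitBall L) : L) ≠ 0 :=
    fun h => ht0 ((coe_mapBallPt_eq_zero_iff ε hεm φ hφ t).mp h)
  have hxy := evX_div_mapBallPt (W := W) ε hε hεm φ hφ t
  refine ⟨?_, ?_⟩
  · have hns := nonsingular_ptOfZ (W := W) (mapBallPt ε hεm t) ht0'
    rwa [hxy.1, hxy.2] at hns
  · rw [ptOfZ_of_ne_zero ht0']
    simp only [Affine.Point.some.injEq]
    exact ⟨hxy.1, hxy.2⟩

omit [CompleteSpace K] [ContinuousSMul A (unitBall K)] in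
/-- `P(ε 0) = O`. [cite: SilvermanAEC2009, Prop. VII.2.2] -/
theorem ptOfZ_mapBallPt_zero (ε : unitBall K →ₐ[A] unitBall L)
    (hεm : ∀ x ∈ (ballNilIdeal K).toIdeal, ε x ∈ (ballNilIdeal L).toIdeal) : ptOfZ L W (mapBallPt ε hεm 0) = 0 :=
  ptOfZ_of_eq_zero (by rw [coe_mapBallPt, ZeroMemClass.coe_zero, map_zero]; rfl)

omit [UniformSpace A] [DiscreteUniformity A] [CompleteSpace K] [ContinuousSMul A (unitBall K)] [CompleteSpace L]
  [ContinuousSMul A (unitBall L)] hEL in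
/-- **`z`-coordinates are natural**: for `P ∈ E₁(K)`, the image parameter `ε(z(P))` read in `L` is `φ(z(P))` (the form used by the
Tate-module matching: `P ↦ z(P)` commutes with `φ`). [cite: SilvermanAEC2009, Prop. VII.2.2] -/
theorem coe_mapBallPt_zPt [(curveOver K W).IsElliptic] (ε : unitBall K →ₐ[A] unitBall L)
    (hεm : ∀ x ∈ (ballNilIdeal K).toIdeal, ε x ∈ (ballNilIdeal L).toIdeal) (φ : K →+* L) (hφ : ∀ x : unitBall K, φ x = ε x)
    {P : (curveOver K W).toAffine.Point} (hP : P ∈ kernel (NormedField.valuation (K := K)) (curveOver K W)) :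
    (((mapBallPt ε hεm (zPt P hP) : (ballNilIdeal L).toIdeal) : unitBall L) : L) = φ P.zCoord := by
  rw [coe_mapBallPt, ← hφ, coe_zPt]

end Naturality

end Literature.NumberTheory.EllipticCurves

end
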